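import Summits.QuantumFields.BalabanUV.Beta.SpineRecursiveW

/-!
# «SLOT-SREC» part 2 («SLOT-W») — the recursive SECOND-order tables with slots: `T2RecOf G S M`, `WrecOf G S M`, the comb objects
# `T2RecAt ρ` / `WrecAt ρ` recovered at `(G, S, M) := (j ↦ coDressKBmAt ρ Lc (KInvStep Lc j), SpureRecAt ρ, M1At ρ cΛ)`
# (binder row D1, the row-D1 OWNER's leaf row «HP-SYM-SLOTS», RULING R-D1-g25-2 (3))

HONEST FRAMING (cell charter, verbatim): «discharging BetaPertH makes Balaban's UV stability UNCONDITIONAL — a real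
constructive-QFT result; it is NOT the continuum limit and NOT the Clay problem.»  DERIVED cell leaf (pub-balaban β sub-cell, binder row D1,
cross-cell idle seat `b2b-balaban-t4-ne7b-formalise-leaf-05` gen 22, leaf row «HP-SYM-SLOTS» ∕ «SLOT-SREC» part 2); no statement of Bałaban's
papers is typed here, no `[cite:]` tag, no `Prop` fact; it instantiates no binder of the β-function wall; it does NOT name, replace or pre-empt
any wall literal (the W-instantiated literal `JsRecWAtOf` and its S-side `JsRecBmAtOf` are NOT re-typed here).  NOT D1, NOT `BetaPertH`; NOT
continuum; NOT Clay.
HONEST DEPENDENCY (cell records, verbatim): «continuum YM on T⁴ ⇐ BetaPertH ∧ nine spine estimates (0/9 proved); BetaPertH ⇐ (D1) ∧ (D4) ∧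
CAP+tail; G-an2-4 gates asym, D1 and NE2/3/4.»

## What is here (a TABLE-SLOT refactor; the landed files stay byte-identical)

an2's `SpineRooted.T2RecAt ρ …` / `WrecAt ρ … j := W2SymOfK G_j Lc (SpureRecAt ρ … j) (M1At ρ cΛ j) (T2RecAt ρ … j) (M2Of mixFF j)`
(`SpineRecursiveW` §3) read the background through the dressed step propagators `G_j = coDressKBmAt ρ Lc (KInvStep Lc j)`, the unfolded
first-order tables `SpureRecAt ρ … j` and the multiplier tables `M1At ρ cΛ j` — and through the ALREADY-slotted binder tables `vh₂S`, `mixFF`.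
Since an2's `e4OfKW` / an1's `W2SymOfK` are generic in `(K, S, M, W)`, the three remaining ingredients become FAMILY PARAMETERS
`G : ℕ → MKer (d+1) (Fib d)`, `S M : ℕ → Fin (d+1) → (Fin (d+1) → ℤ) → MKer (d+1) (Fib d)` under DISPLAYED letters (no named `Prop`):
(DG) `∀ j, ∃ δ C, 0 < δ ∧ 0 ≤ C ∧ Decays (G j) C δ` · (LS) `∀ j, ∃ Cs δ, 0 < δ ∧ LocStencil (S j) Cs δ` · (LM) `∀ j, ∃ CM δ, 0 < δ ∧ VertexFamily (M j) Lc CM δ`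
· (TG) `∀ j t, shiftK (−Lc•t) (G j) = G j` · (TS) `∀ j κ u t, S j κ (u + Lc•t) = shiftK (−Lc•t) (S j κ u)` · (TM) `∀ j μ w t, M j μ (w + t) = shiftK (−Lc•t) (M j μ w)`.
* §1 **`T2RecOf G S M cE₂ cB T vh₂S mixFF`** (structural recursion, verbatim `T2RecAt` with the slots), **`WrecOf … j`**; `T2RecOf_zero_level`,
  `T2RecOf_succ` (through `WrecOf j`, `rfl`), `WrecOf_swap`; **BRIDGES `T2RecOf_comb`, `WrecOf_comb`**: at the comb data the slots ARE
  `T2RecAt ρ` / `WrecAt ρ`.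
* §2 LOCALITY under (DG)(LS)(LM) + the binder letters `hB`/`hmix` of `SpineRecursiveW`: `vertexFamily₂_WrecOf_of`, **`T2RecOf_loc`** (induction),
  **`vertexFamily₂_WrecOf'`** — the proofs of `T2RecAt_loc` / `vertexFamily₂_WrecAt'` with the letters for `decays_coDressKBmAt_KInvStep` /
  `locStencil_SpureRecAt` / `vertexFamily_M1At`.
* §3 COVARIANCE under (TG)(TS)(TM) + `hBt`/`hmixt`: **`T2RecOf_translate`**, **`WrecOf_translate`**.
* §4 the W-data PACKAGE over the slot: `CwRecGOf`, `δwRecGOf`, `δwRecGOf_pos`, **`WrecOf_loc₂`** (the `(hW)` binder shape of `JsRecBmAtOf`).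
* §5 COMB CONSISTENCY: `T2RecAt_loc` re-derived through the slot.
Instances intended: the frozen comb (bridges above) and «JsB12Sym» with `G := j ↦ coDressKSymAt (ctr) Lc (KInvStep Lc j)` (K1-a), `S :=
SpureRecOf V H G` (part 1 `RecursiveStencilSlot`), `M := M1Of H cΛ` (`MultiplierTableSlot`) — none typed here.

All declarations `[folklore]` except the two slot definitions and the package data `[our object]` (parametrised candidates, asserting nothing);
axioms standard.  Provenance: b2b-balaban β sub-cell, cross-cell seat b2b-balaban-t4-ne7b-formalise-leaf-05 gen 22, 2026-08-21 (v1); over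
`SpineRecursiveW` (an2 gen 17), an1's `SecondOrderResponse` / `WilsonBiStencil` / `BalabanStepW2` BY NAME; no existing file touched.
-/

noncomputable section

open Finset
open scoped BigOperators
open Literature.MathematicalPhysics.QuantumFieldTheory
open Literature.MathematicalPhysics.QuantumFieldTheory.Balaban1983to89
open Literature.MathematicalPhysics.QuantumFieldTheory.Balaban1983to89.Beta
open B12Sec2to5 (l1 l1_nonneg)
open ExpKernelCalculus (MKer Decays BiLoc VertexFamily VertexFamily₂ shiftK)
open OneStepResolventKernel (Fib LocStencil JetData)
open OneStepKernelFamily (KInvStep)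
open AffineAveraging (box toSite)
open BalabanCompositeJets (LocStencil₂)
open BalabanStepW2 (M2Of locStencilFM_M2Of M2Of_translate wV4 wB2 locStencil₂_smul' locStencil₂_add')
open SecondOrderResponse (W2SymOfK W2SymOfK_swap LocStencilFM vertexFamily₂_W2SymOfK' W2SymOfK_translate)
open WilsonBiStencil (wilsonW₂ wBound₂ biLoc_wilsonW₂ wilsonW₂_translate)
open Summit.QuantumFields.BalabanUV.Beta.TameKernelCalculus
open Summit.QuantumFields.BalabanUV.Beta.AxialDressingRooted (coDressKBmAt decays_coDressKBmAt_KInvStep shiftK_coDressKBmAt_KInvStep)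

namespace Summit.QuantumFields.BalabanUV.Beta.SpineRooted

variable {d : ℕ}

/-! ## §1 The slotted second-order tables and their bridges -/

section Def

variable (d) (Lc : ℕ)

/-- [our object — a slotted CANDIDATE, asserting nothing] **THE RECURSIVELY TYPED SECOND-ORDER FIELD TABLES WITH SLOTS**: an2's `T2RecAt ρ`
with `coDressKBmAt ρ Lc (KInvStep Lc j) ↦ G j`, `SpureRecAt ρ … j ↦ S j`, `M1At ρ cΛ j ↦ M j`: member `0` = `cE₂ • wilsonW₂ d T + cB • vh₂S`;
member `j+1` = `(cE₂·wV4 (j+1)) • e4OfKW Lc (G j) (S j) (M j) (W2SymOfK (G j) Lc (S j) (M j) (T2RecOf … j) (M2Of mixFF j)) + (cB·wB2 (j+1)) • vh₂S`. -/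
def T2RecOf (G : ℕ → MKer (d + 1) (Fib d)) (S M : ℕ → Fin (d + 1) → (Fin (d + 1) → ℤ) → MKer (d + 1) (Fib d)) (cE₂ cB : ℝ)
    (T : Fin 4 → Fin 4 → Fin 4 → Fin 4 → ℝ)
    (vh₂S mixFF : Fin (d + 1) → (Fin (d + 1) → ℤ) → Fin (d + 1) → (Fin (d + 1) → ℤ) → MKer (d + 1) (Fib d)) :
    ℕ → Fin (d + 1) → (Fin (d + 1) → ℤ) → Fin (d + 1) → (Fin (d + 1) → ℤ) → MKer (d + 1) (Fib d)
  | 0 => fun κ u κ' u' => cE₂ • wilsonW₂ d T κ u κ' u' + cB • vh₂S κ u κ' u'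
  | j + 1 => fun κ u κ' u' =>
      (cE₂ * wV4 d Lc (j + 1)) •
          e4OfKW Lc (G j) (S j) (M j) (W2SymOfK (G j) Lc (S j) (M j) (T2RecOf G S M cE₂ cB T vh₂S mixFF j) (M2Of d Lc mixFF j)) κ u κ' u'
        + (cB * wB2 d Lc (j + 1)) • vh₂S κ u κ' u'

/-- [our object — a slotted CANDIDATE, asserting nothing] **THE W-TABLES WITH SLOTS**: `WrecOf … j := W2SymOfK (G j) Lc (S j) (M j) (T2RecOf … j) (M2Of mixFF j)`. -/
def WrecOf (G : ℕ → MKer (d + 1) (Fib d)) (S M : ℕ → Fin (d + 1) → (Fin (d + 1) → ℤ) → MKer (d + 1) (Fib d)) (cE₂ cB : ℝ)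
    (T : Fin 4 → Fin 4 → Fin 4 → Fin 4 → ℝ)
    (vh₂S mixFF : Fin (d + 1) → (Fin (d + 1) → ℤ) → Fin (d + 1) → (Fin (d + 1) → ℤ) → MKer (d + 1) (Fib d)) (j : ℕ) :
    Fin (d + 1) → (Fin (d + 1) → ℤ) → Fin (d + 1) → (Fin (d + 1) → ℤ) → MKer (d + 1) (Fib d) :=
  W2SymOfK (G j) Lc (S j) (M j) (T2RecOf d Lc G S M cE₂ cB T vh₂S mixFF j) (M2Of d Lc mixFF j)

variable {d Lc}
variable (G : ℕ → MKer (d + 1) (Fib d)) (S M : ℕ → Fin (d + 1) → (Fin (d + 1) → ℤ) → MKer (d + 1) (Fib d)) (cE₂ cB : ℝ)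
  (T : Fin 4 → Fin 4 → Fin 4 → Fin 4 → ℝ)
  (vh₂S mixFF : Fin (d + 1) → (Fin (d + 1) → ℤ) → Fin (d + 1) → (Fin (d + 1) → ℤ) → MKer (d + 1) (Fib d))

/-- [folklore] Member `0` of `T2RecOf` (slot-free apart from the binder table). -/
@[simp] theorem T2RecOf_zero_level : T2RecOf d Lc G S M cE₂ cB T vh₂S mixFF 0 =
    fun κ u κ' u' => cE₂ • wilsonW₂ d T κ u κ' u' + cB • vh₂S κ u κ' u' := rfl

/-- [folklore] Member `j+1` of `T2RecOf` THROUGH `WrecOf … j` (`rfl`). -/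
theorem T2RecOf_succ (j : ℕ) : T2RecOf d Lc G S M cE₂ cB T vh₂S mixFF (j + 1) = fun κ u κ' u' =>
    (cE₂ * wV4 d Lc (j + 1)) • e4OfKW Lc (G j) (S j) (M j) (WrecOf d Lc G S M cE₂ cB T vh₂S mixFF j) κ u κ' u' +
      (cB * wB2 d Lc (j + 1)) • vh₂S κ u κ' u' := rfl

/-- [folklore] Unfolding lemma for `WrecOf`. -/
theorem WrecOf_eq (j : ℕ) : WrecOf d Lc G S M cE₂ cB T vh₂S mixFF j =
    W2SymOfK (G j) Lc (S j) (M j) (T2RecOf d Lc G S M cE₂ cB T vh₂S mixFF j) (M2Of d Lc mixFF j) := rfl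

/-- [folklore] **SWAP SYMMETRY** of every `WrecOf … j` (`W2SymOfK_swap`). -/
theorem WrecOf_swap (j : ℕ) (μ : Fin (d + 1)) (y : Fin (d + 1) → ℤ) (ν : Fin (d + 1)) (y' : Fin (d + 1) → ℤ) :
    WrecOf d Lc G S M cE₂ cB T vh₂S mixFF j ν y' μ y = WrecOf d Lc G S M cE₂ cB T vh₂S mixFF j μ y ν y' :=
  W2SymOfK_swap _ _ _ _ _ _ μ y ν y'

/-- [folklore] **BRIDGE: at the comb data `(j ↦ coDressKBmAt ρ Lc (KInvStep Lc j), SpureRecAt ρ, M1At ρ cΛ)` the slotted tables ARE an2's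
`T2RecAt ρ`** (induction on the level; member `0` by `rfl`). -/
@[simp] theorem T2RecOf_comb [NeZero Lc] (ρ : Fin (d + 1) → ℤ) (cE cVH cΛ : ℝ) :
    ∀ j : ℕ, T2RecOf d Lc (fun j => coDressKBmAt ρ Lc (KInvStep (d := d) Lc j)) (SpureRecAt d Lc ρ cE cVH cΛ) (M1At d Lc ρ cΛ)
      cE₂ cB T vh₂S mixFF j = T2RecAt d Lc ρ cE cVH cΛ cE₂ cB T vh₂S mixFF j
  | 0 => rfl
  | j + 1 => by
    rw [T2RecOf_succ, T2RecAt_succ, WrecOf_eq, T2RecOf_comb ρ cE cVH cΛ j]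
    rfl

/-- [folklore] **BRIDGE: at the comb data the slotted W-tables ARE an2's `WrecAt ρ`.** -/
@[simp] theorem WrecOf_comb [NeZero Lc] (ρ : Fin (d + 1) → ℤ) (cE cVH cΛ : ℝ) (j : ℕ) :
    WrecOf d Lc (fun j => coDressKBmAt ρ Lc (KInvStep (d := d) Lc j)) (SpureRecAt d Lc ρ cE cVH cΛ) (M1At d Lc ρ cΛ) cE₂ cB T vh₂S mixFF j
      = WrecAt d Lc ρ cE cVH cΛ cE₂ cB T vh₂S mixFF j := by
  rw [WrecOf_eq, T2RecOf_comb]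
  rfl

end Def

/-! ## §2 Locality under (DG)(LS)(LM) and the binder letters -/

section Local

variable {Lc : ℕ} [NeZero Lc]
variable {G : ℕ → MKer (d + 1) (Fib d)} {S M : ℕ → Fin (d + 1) → (Fin (d + 1) → ℤ) → MKer (d + 1) (Fib d)} (cE₂ cB : ℝ)
  (T : Fin 4 → Fin 4 → Fin 4 → Fin 4 → ℝ)
  (vh₂S mixFF : Fin (d + 1) → (Fin (d + 1) → ℤ) → Fin (d + 1) → (Fin (d + 1) → ℤ) → MKer (d + 1) (Fib d))

/-- [folklore] **`WrecOf … j` IS A SECOND-ORDER VERTEX FAMILY** once `T2RecOf … j` is a `LocStencil₂` family, under (DG)(LS)(LM) at `j` and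
the mixed-table letter `hmix` (an1's `vertexFamily₂_W2SymOfK'` BY NAME). -/
theorem vertexFamily₂_WrecOf_of (hG : ∀ j : ℕ, ∃ δ C : ℝ, 0 < δ ∧ 0 ≤ C ∧ Decays (G j) C δ)
    (hS : ∀ j : ℕ, ∃ Cs δ : ℝ, 0 < δ ∧ LocStencil (S j) Cs δ) (hM : ∀ j : ℕ, ∃ CM δ : ℝ, 0 < δ ∧ VertexFamily (M j) Lc CM δ)
    (hmix : ∃ C δ : ℝ, 0 < δ ∧ LocStencilFM Lc mixFF C δ) (j : ℕ)
    (hT : ∃ C δ : ℝ, 0 < δ ∧ LocStencil₂ (T2RecOf d Lc G S M cE₂ cB T vh₂S mixFF j) C δ) :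
    ∃ Cw δw : ℝ, 0 < δw ∧ VertexFamily₂ (WrecOf d Lc G S M cE₂ cB T vh₂S mixFF j) Lc Cw δw := by
  obtain ⟨Cs, δs, hδs, hSl⟩ := hS j
  obtain ⟨CM, δM, hδM, hMl⟩ := hM j
  obtain ⟨C₂, δ₂, hδ₂, hT₂⟩ := hT
  obtain ⟨CM₂, δ₃, hδ₃, hM₂⟩ := hmix
  exact vertexFamily₂_W2SymOfK' (hG j) hSl hδs hMl hδM hT₂ hδ₂ (locStencilFM_M2Of hM₂ j) hδ₃

/-- [folklore] **EVERY MEMBER OF `T2RecOf …` IS A `LocStencil₂` FAMILY** under (DG)(LS)(LM), `Lc ≥ 1`, and the binder letters `hB`/`hmix`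
(induction on `j`: an2's `locStencil₂_e4OfKW` over `G j` + the border — the proof of `T2RecAt_loc`). -/
theorem T2RecOf_loc (hLc : 1 ≤ Lc) (hG : ∀ j : ℕ, ∃ δ C : ℝ, 0 < δ ∧ 0 ≤ C ∧ Decays (G j) C δ)
    (hS : ∀ j : ℕ, ∃ Cs δ : ℝ, 0 < δ ∧ LocStencil (S j) Cs δ) (hM : ∀ j : ℕ, ∃ CM δ : ℝ, 0 < δ ∧ VertexFamily (M j) Lc CM δ)
    (hB : ∃ C δ : ℝ, 0 < δ ∧ LocStencil₂ vh₂S C δ) (hmix : ∃ C δ : ℝ, 0 < δ ∧ LocStencilFM Lc mixFF C δ) :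
    ∀ j : ℕ, ∃ C δ : ℝ, 0 < δ ∧ LocStencil₂ (T2RecOf d Lc G S M cE₂ cB T vh₂S mixFF j) C δ
  | 0 => by
    obtain ⟨CB, δB, hδB, hBl⟩ := hB
    have hWil : LocStencil₂ (wilsonW₂ d T) (wBound₂ d T * Real.exp (8 * δB)) δB := fun κ u κ' u' => biLoc_wilsonW₂ T hδB.le κ u κ' u'
    rw [T2RecOf_zero_level]
    exact ⟨_, δB, hδB, locStencil₂_add' (locStencil₂_smul' cE₂ hWil) (locStencil₂_smul' cB hBl)⟩
  | j + 1 => by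
    have hT := T2RecOf_loc hLc hG hS hM hB hmix j
    obtain ⟨CB, δB, hδB, hBl⟩ := hB
    have hWv := vertexFamily₂_WrecOf_of cE₂ cB T vh₂S mixFF hG hS hM hmix j hT
    obtain ⟨C4, δ4, hδ4, h4⟩ := locStencil₂_e4OfKW (d := d) (Lc := Lc) hLc (hG j) (hS j) (hM j) hWv
      (WrecOf_swap G S M cE₂ cB T vh₂S mixFF j)
    have hm : 0 < min δ4 δB := lt_min hδ4 hδB
    rw [T2RecOf_succ]
    exact ⟨_, _, hm, locStencil₂_add' (locStencil₂_smul' _ (h4.mono (min_le_left δ4 δB)))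
      (locStencil₂_smul' _ (hBl.mono (min_le_right δ4 δB)))⟩

/-- [folklore] **`WrecOf … j` IS A SECOND-ORDER VERTEX FAMILY** under (DG)(LS)(LM), `Lc ≥ 1`, `hB`, `hmix` (some positive rate). -/
theorem vertexFamily₂_WrecOf' (hLc : 1 ≤ Lc) (hG : ∀ j : ℕ, ∃ δ C : ℝ, 0 < δ ∧ 0 ≤ C ∧ Decays (G j) C δ)
    (hS : ∀ j : ℕ, ∃ Cs δ : ℝ, 0 < δ ∧ LocStencil (S j) Cs δ) (hM : ∀ j : ℕ, ∃ CM δ : ℝ, 0 < δ ∧ VertexFamily (M j) Lc CM δ)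
    (hB : ∃ C δ : ℝ, 0 < δ ∧ LocStencil₂ vh₂S C δ) (hmix : ∃ C δ : ℝ, 0 < δ ∧ LocStencilFM Lc mixFF C δ) (j : ℕ) :
    ∃ Cw δw : ℝ, 0 < δw ∧ VertexFamily₂ (WrecOf d Lc G S M cE₂ cB T vh₂S mixFF j) Lc Cw δw :=
  vertexFamily₂_WrecOf_of cE₂ cB T vh₂S mixFF hG hS hM hmix j (T2RecOf_loc cE₂ cB T vh₂S mixFF hLc hG hS hM hB hmix j)

end Local

/-! ## §3 Joint block covariance under (TG)(TS)(TM) and the binder letters -/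

section Translate

variable {Lc : ℕ} [NeZero Lc]
variable {G : ℕ → MKer (d + 1) (Fib d)} {S M : ℕ → Fin (d + 1) → (Fin (d + 1) → ℤ) → MKer (d + 1) (Fib d)} (cE₂ cB : ℝ)
  (T : Fin 4 → Fin 4 → Fin 4 → Fin 4 → ℝ)
  {vh₂S mixFF : Fin (d + 1) → (Fin (d + 1) → ℤ) → Fin (d + 1) → (Fin (d + 1) → ℤ) → MKer (d + 1) (Fib d)}

/-- [folklore] **JOINT BLOCK COVARIANCE OF `T2RecOf`** under (TG)(TS)(TM), `hBt`, `hmixt` (simultaneous induction on `j`: `wilsonW₂_translate`,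
the binders' covariance, an2's `e4OfKW_translate` over the `Lc`-periodic `G j`, an1's `W2SymOfK_translate` — the proof of `T2RecAt_translate`). -/
theorem T2RecOf_translate (hGt : ∀ (j : ℕ) (t : Fin (d + 1) → ℤ), shiftK (-((Lc : ℤ) • t)) (G j) = G j)
    (hSt : ∀ (j : ℕ) (κ : Fin (d + 1)) (u t : Fin (d + 1) → ℤ), S j κ (u + (Lc : ℤ) • t) = shiftK (-((Lc : ℤ) • t)) (S j κ u))
    (hMt : ∀ (j : ℕ) (μ : Fin (d + 1)) (w t : Fin (d + 1) → ℤ), M j μ (w + t) = shiftK (-((Lc : ℤ) • t)) (M j μ w))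
    (hBt : ∀ (κ : Fin (d + 1)) (u : Fin (d + 1) → ℤ) (κ' : Fin (d + 1)) (u' t : Fin (d + 1) → ℤ),
      vh₂S κ (u + (Lc : ℤ) • t) κ' (u' + (Lc : ℤ) • t) = shiftK (-((Lc : ℤ) • t)) (vh₂S κ u κ' u'))
    (hmixt : ∀ (κ : Fin (d + 1)) (u : Fin (d + 1) → ℤ) (μ : Fin (d + 1)) (w t : Fin (d + 1) → ℤ),
      mixFF κ (u + (Lc : ℤ) • t) μ (w + t) = shiftK (-((Lc : ℤ) • t)) (mixFF κ u μ w)) :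
    ∀ (j : ℕ) (κ : Fin (d + 1)) (u : Fin (d + 1) → ℤ) (κ' : Fin (d + 1)) (u' t : Fin (d + 1) → ℤ),
      T2RecOf d Lc G S M cE₂ cB T vh₂S mixFF j κ (u + (Lc : ℤ) • t) κ' (u' + (Lc : ℤ) • t)
        = shiftK (-((Lc : ℤ) • t)) (T2RecOf d Lc G S M cE₂ cB T vh₂S mixFF j κ u κ' u')
  | 0, κ, u, κ', u', t => by
    show cE₂ • wilsonW₂ d T κ (u + (Lc : ℤ) • t) κ' (u' + (Lc : ℤ) • t) + cB • vh₂S κ (u + (Lc : ℤ) • t) κ' (u' + (Lc : ℤ) • t)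
      = shiftK (-((Lc : ℤ) • t)) (cE₂ • wilsonW₂ d T κ u κ' u' + cB • vh₂S κ u κ' u')
    rw [wilsonW₂_translate, hBt]
    rfl
  | j + 1, κ, u, κ', u', t => by
    have IH := T2RecOf_translate hGt hSt hMt hBt hmixt j
    have hWt : ∀ (μ : Fin (d + 1)) (y : Fin (d + 1) → ℤ) (ν : Fin (d + 1)) (y' s : Fin (d + 1) → ℤ),
        WrecOf d Lc G S M cE₂ cB T vh₂S mixFF j μ (y + s) ν (y' + s) = shiftK (-((Lc : ℤ) • s)) (WrecOf d Lc G S M cE₂ cB T vh₂S mixFF j μ y ν y') :=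
      fun μ y ν y' s => W2SymOfK_translate (N := Lc) (hGt j) (hSt j) (hMt j) IH (M2Of_translate (Lc := Lc) hmixt j) μ y ν y' s
    rw [T2RecOf_succ]
    show (cE₂ * wV4 d Lc (j + 1)) • e4OfKW Lc (G j) (S j) (M j) (WrecOf d Lc G S M cE₂ cB T vh₂S mixFF j) κ (u + (Lc : ℤ) • t) κ' (u' + (Lc : ℤ) • t)
        + (cB * wB2 d Lc (j + 1)) • vh₂S κ (u + (Lc : ℤ) • t) κ' (u' + (Lc : ℤ) • t)
      = shiftK (-((Lc : ℤ) • t)) ((cE₂ * wV4 d Lc (j + 1)) • e4OfKW Lc (G j) (S j) (M j) (WrecOf d Lc G S M cE₂ cB T vh₂S mixFF j) κ u κ' u'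
          + (cB * wB2 d Lc (j + 1)) • vh₂S κ u κ' u')
    rw [e4OfKW_translate (hGt j) (hSt j) (hMt j) hWt, hBt]
    rfl

/-- [folklore] **(Wt) OF THE SLOTTED W-TABLES**: `WrecOf … j μ (y + t) ν (y′ + t) = shiftK (−Lc•t) (WrecOf … j μ y ν y′)` under the same letters. -/
theorem WrecOf_translate (hGt : ∀ (j : ℕ) (t : Fin (d + 1) → ℤ), shiftK (-((Lc : ℤ) • t)) (G j) = G j)
    (hSt : ∀ (j : ℕ) (κ : Fin (d + 1)) (u t : Fin (d + 1) → ℤ), S j κ (u + (Lc : ℤ) • t) = shiftK (-((Lc : ℤ) • t)) (S j κ u))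
    (hMt : ∀ (j : ℕ) (μ : Fin (d + 1)) (w t : Fin (d + 1) → ℤ), M j μ (w + t) = shiftK (-((Lc : ℤ) • t)) (M j μ w))
    (hBt : ∀ (κ : Fin (d + 1)) (u : Fin (d + 1) → ℤ) (κ' : Fin (d + 1)) (u' t : Fin (d + 1) → ℤ),
      vh₂S κ (u + (Lc : ℤ) • t) κ' (u' + (Lc : ℤ) • t) = shiftK (-((Lc : ℤ) • t)) (vh₂S κ u κ' u'))
    (hmixt : ∀ (κ : Fin (d + 1)) (u : Fin (d + 1) → ℤ) (μ : Fin (d + 1)) (w t : Fin (d + 1) → ℤ),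
      mixFF κ (u + (Lc : ℤ) • t) μ (w + t) = shiftK (-((Lc : ℤ) • t)) (mixFF κ u μ w))
    (j : ℕ) (μ : Fin (d + 1)) (y : Fin (d + 1) → ℤ) (ν : Fin (d + 1)) (y' t : Fin (d + 1) → ℤ) :
    WrecOf d Lc G S M cE₂ cB T vh₂S mixFF j μ (y + t) ν (y' + t) = shiftK (-((Lc : ℤ) • t)) (WrecOf d Lc G S M cE₂ cB T vh₂S mixFF j μ y ν y') :=
  W2SymOfK_translate (N := Lc) (hGt j) (hSt j) (hMt j) (T2RecOf_translate cE₂ cB T hGt hSt hMt hBt hmixt j) (M2Of_translate (Lc := Lc) hmixt j)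
    μ y ν y' t

end Translate

/-! ## §4 The W-data package over the slot (the `(hW)` binder shape of `JsRecBmAtOf`) -/

section Package

variable {Lc : ℕ} [NeZero Lc] (hLc : 1 ≤ Lc)
  {G : ℕ → MKer (d + 1) (Fib d)} {S M : ℕ → Fin (d + 1) → (Fin (d + 1) → ℤ) → MKer (d + 1) (Fib d)}
  (hG : ∀ j : ℕ, ∃ δ C : ℝ, 0 < δ ∧ 0 ≤ C ∧ Decays (G j) C δ) (hS : ∀ j : ℕ, ∃ Cs δ : ℝ, 0 < δ ∧ LocStencil (S j) Cs δ)
  (hM : ∀ j : ℕ, ∃ CM δ : ℝ, 0 < δ ∧ VertexFamily (M j) Lc CM δ) (cE₂ cB : ℝ) (T : Fin 4 → Fin 4 → Fin 4 → Fin 4 → ℝ)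
  {vh₂S : Fin (d + 1) → (Fin (d + 1) → ℤ) → Fin (d + 1) → (Fin (d + 1) → ℤ) → MKer (d + 1) (Fib d)}
  (hB : ∃ C δ : ℝ, 0 < δ ∧ LocStencil₂ vh₂S C δ)
  {mixFF : Fin (d + 1) → (Fin (d + 1) → ℤ) → Fin (d + 1) → (Fin (d + 1) → ℤ) → MKer (d + 1) (Fib d)}
  (hmix : ∃ C δ : ℝ, 0 < δ ∧ LocStencilFM Lc mixFF C δ)

/-- [our object] The packaged localisation CONSTANT of `WrecOf … j` (`Classical.choose`). -/
def CwRecGOf (j : ℕ) : ℝ := (vertexFamily₂_WrecOf' cE₂ cB T vh₂S mixFF hLc hG hS hM hB hmix j).choose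

/-- [our object] The packaged localisation RATE of `WrecOf … j`. -/
def δwRecGOf (j : ℕ) : ℝ := (vertexFamily₂_WrecOf' cE₂ cB T vh₂S mixFF hLc hG hS hM hB hmix j).choose_spec.choose

/-- [folklore] The packaged rate is positive. -/
theorem δwRecGOf_pos (j : ℕ) : 0 < δwRecGOf hLc hG hS hM cE₂ cB T hB hmix j :=
  (vertexFamily₂_WrecOf' cE₂ cB T vh₂S mixFF hLc hG hS hM hB hmix j).choose_spec.choose_spec.1

/-- [folklore] **THE `(hW)` BINDER SHAPE OF `JsRecBmAtOf`, FOR THE SLOTTED W-TABLES.** -/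
theorem WrecOf_loc₂ (j : ℕ) :
    VertexFamily₂ (WrecOf d Lc G S M cE₂ cB T vh₂S mixFF j) Lc (CwRecGOf hLc hG hS hM cE₂ cB T hB hmix j)
      (δwRecGOf hLc hG hS hM cE₂ cB T hB hmix j) :=
  (vertexFamily₂_WrecOf' cE₂ cB T vh₂S mixFF hLc hG hS hM hB hmix j).choose_spec.choose_spec.2

end Package

/-! ## §5 The comb instance through the slot (consistency check; nothing new about the comb) -/

section Comb

variable {Lc : ℕ} [NeZero Lc] {r : Fin (d + 1) → ℕ} (cE cVH cΛ cE₂ cB : ℝ) (T : Fin 4 → Fin 4 → Fin 4 → Fin 4 → ℝ)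
  {vh₂S mixFF : Fin (d + 1) → (Fin (d + 1) → ℤ) → Fin (d + 1) → (Fin (d + 1) → ℤ) → MKer (d + 1) (Fib d)}

/-- [folklore] CONSISTENCY: an2's `T2RecAt_loc` re-derived through the slot (in-block root) — (DG)(LS)(LM) for the comb are
`decays_coDressKBmAt_KInvStep` / `locStencil_SpureRecAt` / `vertexFamily_M1At` BY NAME. -/
theorem T2RecAt_loc_of_slot (hLc : 1 ≤ Lc) (hr : r ∈ box (d + 1) Lc) (hB : ∃ C δ : ℝ, 0 < δ ∧ LocStencil₂ vh₂S C δ)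
    (hmix : ∃ C δ : ℝ, 0 < δ ∧ LocStencilFM Lc mixFF C δ) (j : ℕ) :
    ∃ C δ : ℝ, 0 < δ ∧ LocStencil₂ (T2RecAt d Lc (toSite r) cE cVH cΛ cE₂ cB T vh₂S mixFF j) C δ := by
  rw [← T2RecOf_comb]
  exact T2RecOf_loc cE₂ cB T vh₂S mixFF hLc (fun j => decays_coDressKBmAt_KInvStep (d := d) hr j)
    (fun j => locStencil_SpureRecAt hLc hr cE cVH cΛ j) (fun j => ⟨_, 1, one_pos, vertexFamily_M1At hLc hr cΛ j zero_le_one⟩) hB hmix j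

end Comb

end Summit.QuantumFields.BalabanUV.Beta.SpineRooted

end
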